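/-
Copyright (c) 2026 the pub-hodgecm-mathlib formalisation cell (harness21).  Prover seat hodgecm-mathlib-K2E1-p14 (g0), Track B «K2-LIT» ENGINE E1, h413 =
`stmt-HodgeConjecture-24833`, route `HCCMUnconditional`, campaign «5Res» (b) «BL-2(χ,τ)» character twins of the spherical line at `N = 2`; SHEET (93)(b) row 1 of
K2-defs1 (g6) (`K2/K2-defs1/g6/SHEET-5Res-b-chi-twins.K2-defs1-g6.md`), dealt by K2E1-plan (g6) (95) 2026-09-04T10:49:07Z; REPORT-FIRST R1 on the K2 bus 10:55:18Z (dealer (97) «=» BY NAME 10:49:42Z).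
-/
import Summits.HodgeConjecture.HodgeConjecture.Theorems.K2E1CharacterEisensteinU2Defs      -- ★ p859441 DEFS LEAF: `firstEntryUnit`, `IsChiSection`, `reflectChar`, `flatSectionU_borel_mul_of_isChiSection`
import Summits.HodgeConjecture.HodgeConjecture.Theorems.K2E1BorelEisensteinGodementU2       -- ★ `diagUnit` currency: `ideleNorm_lastEntryUnit_inv`, `borelHeight_borel_mul_eq_ideleNorm_diagUnit_zero`
import Literature.NumberTheory.Automorphic.IdeleClassGroupProofs                         -- ★ `ideleNorm_ne_zero`
import Literature.NumberTheory.Automorphic.UnitaryGroupGlobalGenericity                 -- ★ `conjAdele_conjAdele` (`(c ⊗ 1)² = 1`)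
import HarnessLib

/-!
# h413 ∕ Track B «K2-LIT», 5Res (b) row 1 — `K2E1ChiSectionBridgeU2`: the `U(J_N)` normalisation bridge `‖b_{N−1,N−1}‖_𝔸⁻¹ = ‖b₀₀‖_𝔸` on `B(𝔸_F)`, the three
# currencies of `χ`-equivariance (`IsChiSection` ∕ `diagUnit hb 0` ∕ the Borel law `f(bg) = χ(u)‖u‖^z f(g)`), and the constructors of `χ`-sections

Cell `pub/hodgecm-mathlib`, crux H413 = `stmt-HodgeConjecture-24833`.  THEOREMS ONLY (no `def`, no `instance`, no `notation`, no named-fact hypothesis, no `sorry`); lane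
`--kind proof --supports stmt-HodgeConjecture-24833 --as helper` (count-neutral).  Generic `F E c N` (`[NeZero N]`) except §3 (`N = 2`, still generic `F E c`: the CM users
`F = L⁺`, `E = L`, `c = complexConj L` instantiate by `exact`).

THE MATHEMATICS ([MoeglinWaldspurger1995, I.2.17, II.1.5, II.1.7]; [GelbartRogawski1991, §3.1]; [Rogawski1990, §1.9–§1.10, §2.2]; [Garrett2018, §2.2]).  For an upper
triangular `b ∈ U(J_N)(𝔸_F) ≤ GL_N(𝔸_E)` (`B(𝔸_F) = borelAdelic`) the unitarity relation `ᵗ(c b) J_N b = J_N` read at the corner gives **`c(b_{N−1,N−1}) · b₀₀ = 1`** (§1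
`conjAdele_lastEntryUnit_mul_firstEntryUnit`; for `U(1,1)`: `b = (a *; 0 ā⁻¹)`), hence `b₀₀ = (c b_{N−1,N−1})⁻¹` as ideles, **`‖b₀₀‖_𝔸 = ‖b_{N−1,N−1}‖_𝔸⁻¹`** (the idele norm is
`Aut(E∕F)`-invariant, ★ `ideleNorm_galSmul`), `H(b g) = ‖b₀₀‖ · H(g)` (★ `borelHeight_borel_mul` in the first-entry currency), and for every Hecke character `χ` of `E`,
**`χ(b₀₀) = χʷ(b_{N−1,N−1})`** with `χʷ = reflectChar c χ` (`χʷ(a) = χ(c a)⁻¹`, ★ p859441 §3).  Consequences: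
* §2 the ★ DEFS LEAF predicate `IsChiSection χ φ` (`φ(b g) = χ(firstEntryUnit hb)·φ(g)`) IS the older `hφ`-currency `φ(b g) = χ(diagUnit hb 0)·φ(g)` of ★
  `K2E1BorelEisensteinGodementU2` ∕ the R6d₃ files (`firstEntryUnit hb = diagUnit hb 0` definitionally, ★ `K2E1ChiSectionSpaceU2Defs`), and it is checked on the Levi factors: `N(𝔸_F)`-invariance +
  `T(𝔸_F)`-equivariance `φ(diag(d) g) = χ(d₀) φ(g)` (★ Levi decomposition `exists_adelicUnipotent_mul_torusAdelic`);
* §3 (`N = 2`) the flat section `f_z = flatSectionU φ z = φ·H^z` of a `χ`-section obeys THE BOREL LAW `f_z(b g) = χ(u)·‖u‖^z·f_z(g)` (`b₁₀ = 0`, `u = b₀₀`, `‖·‖` the real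
  idele norm) — LITERALLY the `hf` binder of ★ R6d₂ `exists_bound_sub_borelConstantTerm_cm_two[_of_archSmooth]`, ★ MS-2 `K2E1MaassSelbergCMTwoFinal*`, ★
  `bigCell_line_dilation_two`, ★ `unipotent_mul_of_borelLaw` — so those files consume `χ`-sections VERBATIM; conversely every `f` with the Borel law at `z` is the flat
  section of the `χ`-section `f·H^{−z}` (the two currencies are equivalent);
* §4 CONSTRUCTORS: a function of the last row `φ(g) = ψ(e_N·g)` whose dilation law is `ψ(a·r) = χʷ(a)ψ(r)` is a `χ`-section (`e_N·(b g) = b_{N−1,N−1}·(e_N·g)`, ★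
  `lastRow_borel_mul`) — how the (D5-b′) `K_∞`-type angular factors (functions of the last row, ★ `K2E1KTypeAngularSectionU2`) and finite-level data are minted; products
  (`χ₁`-section · `χ₂`-section = `χ₁χ₂`-section; two Borel laws `ε₁, ε₂ : 𝔸_Eˣ → ℂ` through `b₀₀` with `ε₁ε₂ = χ`), right translates `φ(·k)` and right convolutions
  `∫ h(x) φ(· k(x)) dμ` (the Hecke operators of row 10) preserve `χ`-sections.
HONEST LABEL: HC_CM is proved only modulo the 7 printed citations (2 remaining named inputs: hLiu418 = `stmt-HodgeConjecture-24832`, h413 = `stmt-HodgeConjecture-24833`)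
until rung 0 closes; count-neutral helper, proves no printed statement, closes no socket.

## References
* [MoeglinWaldspurger1995] C. Mœglin, J.-L. Waldspurger, *Spectral decomposition and Eisenstein series* (1995), I.2.17 (sections of induced spaces), II.1.5, II.1.7 (`M(w,π)`, `χʷ`).
* [GelbartRogawski1991] S. Gelbart, J. Rogawski, *L-functions and Fourier–Jacobi coefficients for the unitary group U(3)*, Invent. Math. 105 (1991), §3.1 (`I(χ)` on `U(1,1)`, `diag(a, ā⁻¹)`).
* [Rogawski1990] J. D. Rogawski, *Automorphic Representations of Unitary Groups in Three Variables* (1990), §1.9–§1.10 (`B = MN`, `d(a, b, ā⁻¹)`), §2.2 (`H(a m n k) = log a`).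
* [Garrett2018] P. Garrett, *Modern Analysis of Automorphic Forms by Example* 1 (2018), §2.2 (heights, last-row coordinates).
-/

set_option autoImplicit false
-- the mandated namespace repeats the single-problem summit's segment (`HodgeConjecture.HodgeConjecture`)
set_option linter.dupNamespace false

noncomputable section

open NumberField IsDedekindDomain MeasureTheory Matrix
open scoped NNReal MatrixGroups
open Literature.NumberTheory.Automorphic Literature.NumberTheory.Automorphic.UnitaryGroup Literature.NumberTheory.GaloisRepresentations AdelicGroupData
open Summit.HodgeConjecture.HodgeConjecture.Cruxes.H413.K2E1BorelEisensteinU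
open Summit.HodgeConjecture.HodgeConjecture.Cruxes.H413.K2E1CharacterEisensteinU2Defs
open Summit.HodgeConjecture.HodgeConjecture.Cruxes.H413.K2E1BorelEisensteinGodementU2

namespace Summit.HodgeConjecture.HodgeConjecture.Cruxes.H413.K2E1ChiSectionBridgeU2

variable {F E : Type} [Field F] [NumberField F] [Field E] [NumberField E] [Algebra F E] {c : E ≃ₐ[F] E} {N : ℕ} [NeZero N]

/-! ## §1 The unitarity relation `c(b_{N−1,N−1}) · b₀₀ = 1` on `B(𝔸_F)` and its consequences (any `N`) -/

/-- **`c(b_{N−1,N−1}) · b₀₀ = 1` for `b ∈ B(𝔸_F)`**: the corner entry of the unitarity relation `ᵗ(c b) J_N b = J_N` (★ `glDiagonal_mem_unitaryGroupOfForm_antidiagonal_iff` on the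
torus part `diag(bᵢᵢ) ∈ U(J_N)(𝔸_F)`, ★ `glDiagonal_diagUnit_mem_adelic`, at `i = 0`, `rev 0 = ⊤`); for `U(1,1)`, `b = (a *; 0 ā⁻¹)`. [cite: Rogawski1990, §1.9–§1.10] [cite: GelbartRogawski1991, §3.1] -/
theorem conjAdele_lastEntryUnit_mul_firstEntryUnit {b : (quasiSplit F E c N).Adelic} (hb : b ∈ borelAdelic F E c N) :
    conjAdele F E c (lastEntryUnit hb : AdeleRing (𝓞 E) E) * (firstEntryUnit hb : AdeleRing (𝓞 E) E) = 1 := by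
  have h := glDiagonal_diagUnit_mem_adelic hb
  change glDiagonal N (AdeleRing (𝓞 E) E) (diagUnit hb) ∈ unitaryGroupOfForm (conjAdele F E c) (adelicForm E N ((StdForm.antidiagonal N).over E)) at h
  rw [adelicForm_antidiagonal, glDiagonal_mem_unitaryGroupOfForm_antidiagonal_iff] at h
  exact h 0

/-- The same in the idele group: `(c ⊗ 1)(b_{N−1,N−1}) · b₀₀ = 1`. [cite: Rogawski1990, §1.9–§1.10] -/
theorem unitsMap_conjAdele_lastEntryUnit_mul_firstEntryUnit {b : (quasiSplit F E c N).Adelic} (hb : b ∈ borelAdelic F E c N) :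
    Units.map (conjAdele F E c : AdeleRing (𝓞 E) E →+* AdeleRing (𝓞 E) E).toMonoidHom (lastEntryUnit hb) * firstEntryUnit hb = 1 :=
  Units.ext (by rw [Units.val_mul, Units.coe_map, Units.val_one]; exact conjAdele_lastEntryUnit_mul_firstEntryUnit hb)

/-- **`b₀₀ = ((c ⊗ 1) b_{N−1,N−1})⁻¹` as ideles** (for `U(1,1)`: `a = (c(ā⁻¹))⁻¹`). [cite: GelbartRogawski1991, §3.1] [cite: Rogawski1990, §1.10] -/
theorem firstEntryUnit_eq_inv_unitsMap_lastEntryUnit {b : (quasiSplit F E c N).Adelic} (hb : b ∈ borelAdelic F E c N) :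
    firstEntryUnit hb = (Units.map (conjAdele F E c : AdeleRing (𝓞 E) E →+* AdeleRing (𝓞 E) E).toMonoidHom (lastEntryUnit hb))⁻¹ :=
  eq_inv_of_mul_eq_one_right (unitsMap_conjAdele_lastEntryUnit_mul_firstEntryUnit hb)

/-- For an involution `c`: `c(b₀₀) · b_{N−1,N−1} = 1` as well (★ `conjAdele_conjAdele`). [cite: Rogawski1990, §1.9–§1.10] -/
theorem conjAdele_firstEntryUnit_mul_lastEntryUnit (hc : c * c = 1) {b : (quasiSplit F E c N).Adelic} (hb : b ∈ borelAdelic F E c N) :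
    conjAdele F E c (firstEntryUnit hb : AdeleRing (𝓞 E) E) * (lastEntryUnit hb : AdeleRing (𝓞 E) E) = 1 := by
  have h := congrArg (conjAdele F E c) (conjAdele_lastEntryUnit_mul_firstEntryUnit hb)
  rw [map_mul, map_one, conjAdele_conjAdele hc] at h
  rw [mul_comm]
  exact h

/-- For an involution `c`: **`b_{N−1,N−1} = ((c ⊗ 1) b₀₀)⁻¹`** (for `U(1,1)` the familiar `b = (a *; 0 ā⁻¹)`). [cite: GelbartRogawski1991, §3.1] [cite: Rogawski1990, §1.10] -/
theorem lastEntryUnit_eq_inv_unitsMap_firstEntryUnit (hc : c * c = 1) {b : (quasiSplit F E c N).Adelic} (hb : b ∈ borelAdelic F E c N) :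
    lastEntryUnit hb = (Units.map (conjAdele F E c : AdeleRing (𝓞 E) E →+* AdeleRing (𝓞 E) E).toMonoidHom (firstEntryUnit hb))⁻¹ :=
  eq_inv_of_mul_eq_one_right (Units.ext (by rw [Units.val_mul, Units.coe_map, Units.val_one]; exact conjAdele_firstEntryUnit_mul_lastEntryUnit hc hb))

/-- **`‖b₀₀‖_𝔸 = ‖b_{N−1,N−1}‖_𝔸⁻¹` for `b ∈ B(𝔸_F)`** (`ℝ≥0`-valued idele norm; ★ `ideleNorm_lastEntryUnit_inv` read through `firstEntryUnit hb = diagUnit hb 0`, definitional — ★ `K2E1ChiSectionSpaceU2Defs.firstEntryUnit_eq_diagUnit_zero`) — the bridge between the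
★ DEFS LEAF factor `(‖b_{N−1,N−1}‖⁻¹)^z` and the `‖u‖^z`, `u = b₀₀`, of the Borel law. [cite: Rogawski1990, §2.2] [cite: Garrett2018, §2.2] -/
theorem ideleNorm_firstEntryUnit {b : (quasiSplit F E c N).Adelic} (hb : b ∈ borelAdelic F E c N) :
    IdeleClassGroup.ideleNorm E (firstEntryUnit hb) = (IdeleClassGroup.ideleNorm E (lastEntryUnit hb))⁻¹ :=
  (ideleNorm_lastEntryUnit_inv hb).symm

/-- `‖b_{N−1,N−1}‖_𝔸 · ‖b₀₀‖_𝔸 = 1` (`ℝ≥0`). [cite: Rogawski1990, §2.2] -/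
theorem ideleNorm_lastEntryUnit_mul_ideleNorm_firstEntryUnit {b : (quasiSplit F E c N).Adelic} (hb : b ∈ borelAdelic F E c N) :
    IdeleClassGroup.ideleNorm E (lastEntryUnit hb) * IdeleClassGroup.ideleNorm E (firstEntryUnit hb) = 1 := by
  rw [ideleNorm_firstEntryUnit hb, mul_inv_cancel₀ (ideleNorm_ne_zero _)]

/-- The same for the REAL-valued idele norm `GaloisRepresentations.ideleNorm` (the one in the Borel law; ★ `coe_ideleNorm`): `‖b₀₀‖ = ‖b_{N−1,N−1}‖⁻¹`. [cite: Rogawski1990, §2.2] -/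
theorem ideleNorm_firstEntryUnit_real {b : (quasiSplit F E c N).Adelic} (hb : b ∈ borelAdelic F E c N) :
    (ideleNorm (firstEntryUnit hb) : ℝ) = (ideleNorm (lastEntryUnit hb))⁻¹ := by
  rw [← coe_ideleNorm, ← coe_ideleNorm, ideleNorm_firstEntryUnit hb, NNReal.coe_inv]

/-- The real idele norm of `b₀₀` is positive. [folklore] -/
theorem ideleNorm_firstEntryUnit_pos {b : (quasiSplit F E c N).Adelic} (hb : b ∈ borelAdelic F E c N) : 0 < (ideleNorm (firstEntryUnit hb) : ℝ) := by
  rw [← coe_ideleNorm]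
  exact_mod_cast pos_iff_ne_zero.2 (ideleNorm_ne_zero _)

/-- **`H(b g) = ‖b₀₀‖_𝔸 · H(g)` for `b ∈ B(𝔸_F)`** — ★ `borelHeight_borel_mul` (`‖b_{N−1,N−1}‖⁻¹ · H(g)`) in the first-entry currency of the ★ DEFS LEAF (Rogawski (1990) §2.2:
`H(a m n k) = log a`; Garrett (2018) §2.2: `η(p g) = |a∕d| η(g)`). [cite: Rogawski1990, §2.2] [cite: Garrett2018, §2.2] -/
theorem borelHeight_borel_mul_eq_ideleNorm_firstEntryUnit_mul {b : (quasiSplit F E c N).Adelic} (hb : b ∈ borelAdelic F E c N) (g : (quasiSplit F E c N).Adelic) :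
    borelHeight (b * g) = IdeleClassGroup.ideleNorm E (firstEntryUnit hb) * borelHeight g :=
  borelHeight_borel_mul_eq_ideleNorm_diagUnit_zero hb g

/-- **`χ(b₀₀) = χʷ(b_{N−1,N−1})`** for every Hecke character `χ` of `E` and `b ∈ B(𝔸_F)`, `χʷ = reflectChar c χ` (`χʷ(a) = χ((c ⊗ 1) a)⁻¹`): the inducing character read through the
LAST diagonal entry is the reflected one.  No involution hypothesis. [cite: MoeglinWaldspurger1995, II.1.7] [cite: GelbartRogawski1991, §3.1] -/
theorem apply_firstEntryUnit_eq_reflectChar_lastEntryUnit (χ : HeckeCharacter E) {b : (quasiSplit F E c N).Adelic} (hb : b ∈ borelAdelic F E c N) :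
    χ (firstEntryUnit hb) = reflectChar c χ (lastEntryUnit hb) := by
  rw [reflectChar_apply, ← map_inv χ, ← firstEntryUnit_eq_inv_unitsMap_lastEntryUnit hb]

/-- For an involution `c`: **`χʷ(b₀₀) = χ(b_{N−1,N−1})`**. [cite: MoeglinWaldspurger1995, II.1.7] [cite: GelbartRogawski1991, §3.1] -/
theorem reflectChar_apply_firstEntryUnit (hc : c * c = 1) (χ : HeckeCharacter E) {b : (quasiSplit F E c N).Adelic} (hb : b ∈ borelAdelic F E c N) :
    reflectChar c χ (firstEntryUnit hb) = χ (lastEntryUnit hb) := by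
  rw [reflectChar_apply, ← map_inv χ, ← lastEntryUnit_eq_inv_unitsMap_firstEntryUnit hc hb]

/-! ## §2 The currencies of `χ`-equivariance (any `N`) -/

section Currencies

variable {χ : HeckeCharacter E} {φ : (quasiSplit F E c N).Adelic → ℂ}

/-- **`IsChiSection χ φ` ⟺ the older `hφ`-currency `φ(b g) = χ(diagUnit hb 0)·φ(g)`** of ★ `K2E1BorelEisensteinGodementU2.summable_eisensteinSeriesU_flatSectionU_two` and of the
R6d₃ ∕ `U(2,1)` files (same bytes: `firstEntryUnit hb = diagUnit hb 0` definitionally, ★ `K2E1ChiSectionSpaceU2Defs.firstEntryUnit_eq_diagUnit_zero`). [cite: MoeglinWaldspurger1995, I.2.17] -/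
theorem isChiSection_iff_forall_diagUnit :
    IsChiSection χ φ ↔ ∀ (b g : (quasiSplit F E c N).Adelic) (hb : b ∈ borelAdelic F E c N), φ (b * g) = ((χ (diagUnit hb 0) : ℂˣ) : ℂ) * φ g :=
  ⟨fun h b g hb => h b hb g, fun h b hb g => h b g hb⟩

/-- `χ`-sections in the `diagUnit` currency (the ★ `hφ` binder, ready to pass). [cite: MoeglinWaldspurger1995, I.2.17] -/
theorem _root_.Summit.HodgeConjecture.HodgeConjecture.Cruxes.H413.K2E1CharacterEisensteinU2Defs.IsChiSection.borel_mul_diagUnit (hφ : IsChiSection χ φ) (b g : (quasiSplit F E c N).Adelic) (hb : b ∈ borelAdelic F E c N) :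
    φ (b * g) = ((χ (diagUnit hb 0) : ℂˣ) : ℂ) * φ g :=
  hφ b hb g

/-- **The flat section of a `χ`-section in the first-entry currency**: `f_z(b g) = χ(b₀₀) · ‖b₀₀‖_𝔸^z · f_z(g)` for `b ∈ B(𝔸_F)` (★ DEFS LEAF
`flatSectionU_borel_mul_of_isChiSection` has `(‖b_{N−1,N−1}‖⁻¹)^z`; §1 `ideleNorm_firstEntryUnit`). [cite: MoeglinWaldspurger1995, II.1.5] -/
theorem _root_.Summit.HodgeConjecture.HodgeConjecture.Cruxes.H413.K2E1CharacterEisensteinU2Defs.IsChiSection.flatSectionU_borel_mul' (hφ : IsChiSection χ φ) (z : ℂ) {b : (quasiSplit F E c N).Adelic} (hb : b ∈ borelAdelic F E c N)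
    (g : (quasiSplit F E c N).Adelic) :
    flatSectionU φ z (b * g) = ((χ (firstEntryUnit hb) : ℂˣ) : ℂ) * (((IdeleClassGroup.ideleNorm E (firstEntryUnit hb) : ℝ≥0) : ℝ) : ℂ) ^ z * flatSectionU φ z g := by
  rw [flatSectionU_borel_mul_of_isChiSection hφ z hb g, ideleNorm_firstEntryUnit hb]

/-- A `χ`-section on the diagonal torus: `φ(diag(d) g) = χ(d₀) φ(g)` (`d₀ = b₀₀`). [cite: MoeglinWaldspurger1995, I.2.17] [cite: Rogawski1990, §1.10] -/
theorem _root_.Summit.HodgeConjecture.HodgeConjecture.Cruxes.H413.K2E1CharacterEisensteinU2Defs.IsChiSection.torus_mul (hφ : IsChiSection χ φ) {t : (quasiSplit F E c N).Adelic} {d : Fin N → (AdeleRing (𝓞 E) E)ˣ}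
    (hd : glDiagonal N (AdeleRing (𝓞 E) E) d = adelicVal F E c N _ t) (g : (quasiSplit F E c N).Adelic) :
    φ (t * g) = ((χ (d 0) : ℂˣ) : ℂ) * φ g := by
  have ht : t ∈ borelAdelic F E c N := torusAdelic_le_borelAdelic ⟨d, hd⟩
  have h0 : firstEntryUnit ht = d 0 := Units.ext (by rw [coe_firstEntryUnit, ← hd, coe_glDiagonal, Matrix.diagonal_apply_eq])
  rw [hφ.borel_mul ht, h0]

/-- **`χ`-equivariance is checked on the Levi factors**: a left-`N(𝔸_F)`-invariant function that is `T(𝔸_F)`-equivariant through `χ(d₀)` (`t = diag(d)`) is a `χ`-section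
(★ adelic Levi decomposition `B(𝔸_F) = N(𝔸_F)·T(𝔸_F)`, `exists_adelicUnipotent_mul_torusAdelic`; `(u t)₀₀ = t₀₀ = d₀`). [cite: Rogawski1990, §1.9–§1.10] [cite: MoeglinWaldspurger1995, I.2.17] -/
theorem isChiSection_of_unipotent_of_torus
    (hN : ∀ u ∈ adelicUnipotent F E c N, ∀ g : (quasiSplit F E c N).Adelic, φ (u * g) = φ g)
    (hT : ∀ (t : (quasiSplit F E c N).Adelic) (d : Fin N → (AdeleRing (𝓞 E) E)ˣ), glDiagonal N (AdeleRing (𝓞 E) E) d = adelicVal F E c N _ t →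
      ∀ g : (quasiSplit F E c N).Adelic, φ (t * g) = ((χ (d 0) : ℂˣ) : ℂ) * φ g) :
    IsChiSection χ φ := fun b hb g => by
  obtain ⟨u, hu, t, ⟨d, hd⟩, rfl⟩ := exists_adelicUnipotent_mul_torusAdelic hb
  have h0 : firstEntryUnit hb = d 0 := Units.ext (by
    rw [coe_firstEntryUnit, apply_zero_zero_mul_of_mem_borelAdelic u (torusAdelic_le_borelAdelic ⟨d, hd⟩),
      ((mem_upperUnitriangular_iff _).1 ((mem_adelicUnipotent_iff u).1 hu)).2 0, one_mul, ← hd, coe_glDiagonal, Matrix.diagonal_apply_eq])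
  rw [mul_assoc, hN u hu, hT t d hd g, h0]

end Currencies

/-! ## §3 `N = 2`: the Borel law `f_z(b g) = χ(u) · ‖u‖^z · f_z(g)` (`b₁₀ = 0`, `u = b₀₀`) — the `hf` binder of the ★ `U(1,1)` files, both directions -/

section RankOne

variable {χ : HeckeCharacter E}

/-- For `U(J₂)` (generic `F, E, c`): `b ∈ B(𝔸_F)` iff the corner entry `b₁₀` vanishes (★ `mem_borelAdelic_two_iff` is the CM-token special case). [cite: Rogawski1990, §1.10] -/
theorem mem_borelAdelic_two_iff_apply_one_zero (b : (quasiSplit F E c 2).Adelic) :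
    b ∈ borelAdelic F E c 2 ↔ ((b.1 : GL (Fin 2) (AdeleRing (𝓞 E) E)) : Matrix (Fin 2) (Fin 2) (AdeleRing (𝓞 E) E)) 1 0 = 0 := by
  rw [mem_borelAdelic_iff]
  constructor
  · intro h
    exact h (show (id (0 : Fin 2)) < id 1 by decide)
  · intro h i j hij
    fin_cases i <;> fin_cases j <;> simp_all [adelicVal_apply]

/-- **THE BRIDGE — the Borel law of the flat section of a `χ`-section (`N = 2`)**: for `IsChiSection χ φ` and any `z`, `f_z = flatSectionU φ z` satisfies
`f_z(b g) = χ(u) · ‖u‖^z · f_z(g)` whenever `b₁₀ = 0` and `u = b₀₀` (`‖·‖ = GaloisRepresentations.ideleNorm`, real) — LITERALLY the `hf` binder of ★ R6d₂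
`exists_bound_sub_borelConstantTerm_cm_two[_of_archSmooth]` (editions A∕B), ★ `K2E1MaassSelbergCMTwoFinal*`, ★ `bigCell_line_dilation_two`, ★ `unipotent_mul_of_borelLaw`
(for the CM pair `(L⁺, L)` instantiate `E := L` by `exact`).  `f_z ∈ I(χ‖·‖^z) =` K2Liu's `I(s, χ)` at `z = s + ½`. [cite: MoeglinWaldspurger1995, II.1.5] [cite: GelbartRogawski1991, §3.1] -/
theorem _root_.Summit.HodgeConjecture.HodgeConjecture.Cruxes.H413.K2E1CharacterEisensteinU2Defs.IsChiSection.borelLaw_flatSectionU {φ : (quasiSplit F E c 2).Adelic → ℂ} (hφ : IsChiSection χ φ) (z : ℂ) :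
    ∀ (b g : (quasiSplit F E c 2).Adelic) (u : (AdeleRing (𝓞 E) E)ˣ),
      ((b.1 : GL (Fin 2) (AdeleRing (𝓞 E) E)) : Matrix (Fin 2) (Fin 2) (AdeleRing (𝓞 E) E)) 1 0 = 0 →
      (u : AdeleRing (𝓞 E) E) = ((b.1 : GL (Fin 2) (AdeleRing (𝓞 E) E)) : Matrix (Fin 2) (Fin 2) (AdeleRing (𝓞 E) E)) 0 0 →
        flatSectionU φ z (b * g) = ((χ u : ℂˣ) : ℂ) * ((ideleNorm u : ℝ) : ℂ) ^ z * flatSectionU φ z g := fun b g u h10 hu => by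
  have hb : b ∈ borelAdelic F E c 2 := (mem_borelAdelic_two_iff_apply_one_zero b).2 h10
  have hu' : u = firstEntryUnit hb := Units.ext (by rw [hu, coe_firstEntryUnit, adelicVal_apply])
  rw [hφ.flatSectionU_borel_mul' z hb g, coe_ideleNorm, ← hu']

/-- A function with the Borel law at exponent `z` is left-`B(𝔸_F)`-equivariant through `χ(b₀₀)‖b₀₀‖^z` (membership form, `N = 2`). [cite: MoeglinWaldspurger1995, II.1.5] -/
theorem borel_mul_of_borelLaw {f : (quasiSplit F E c 2).Adelic → ℂ} {z : ℂ}
    (hf : ∀ (b g : (quasiSplit F E c 2).Adelic) (u : (AdeleRing (𝓞 E) E)ˣ),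
      ((b.1 : GL (Fin 2) (AdeleRing (𝓞 E) E)) : Matrix (Fin 2) (Fin 2) (AdeleRing (𝓞 E) E)) 1 0 = 0 →
      (u : AdeleRing (𝓞 E) E) = ((b.1 : GL (Fin 2) (AdeleRing (𝓞 E) E)) : Matrix (Fin 2) (Fin 2) (AdeleRing (𝓞 E) E)) 0 0 →
        f (b * g) = ((χ u : ℂˣ) : ℂ) * ((ideleNorm u : ℝ) : ℂ) ^ z * f g)
    {b : (quasiSplit F E c 2).Adelic} (hb : b ∈ borelAdelic F E c 2) (g : (quasiSplit F E c 2).Adelic) :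
    f (b * g) = ((χ (firstEntryUnit hb) : ℂˣ) : ℂ) * ((ideleNorm (firstEntryUnit hb) : ℝ) : ℂ) ^ z * f g :=
  hf b g (firstEntryUnit hb) ((mem_borelAdelic_two_iff_apply_one_zero b).1 hb) (by rw [coe_firstEntryUnit, adelicVal_apply])

/-- `(↑(H g) : ℂ) ≠ 0` (the Borel height is positive). [cite: Garrett2018, §2.2] -/
theorem ofReal_borelHeight_ne_zero (g : (quasiSplit F E c N).Adelic) : (((borelHeight g : ℝ≥0) : ℝ) : ℂ) ≠ 0 := by
  rw [borelHeight_def]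
  exact_mod_cast (inv_ne_zero (vecHeight_lastRow_pos g).ne')

/-- **Undoing the exponent**: `flatSectionU (f · H^{−z}) z = f` (`H > 0`). [cite: MoeglinWaldspurger1995, II.1.5] -/
theorem flatSectionU_mul_borelHeight_cpow_neg (f : (quasiSplit F E c N).Adelic → ℂ) (z : ℂ) :
    flatSectionU (fun g => f g * (((borelHeight g : ℝ≥0) : ℝ) : ℂ) ^ (-z)) z = f := by
  funext g
  simp only [flatSectionU_apply]
  rw [mul_assoc, ← Complex.cpow_add _ _ (ofReal_borelHeight_ne_zero g), neg_add_cancel, Complex.cpow_zero, mul_one]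

/-- **CONVERSE (`N = 2`): every function with the Borel law at exponent `z` is the flat section of a `χ`-section**, namely of `φ = f · H^{−z}` (`IsChiSection χ φ` and
`flatSectionU φ z = f` by `flatSectionU_mul_borelHeight_cpow_neg`) — the `hf` currency of the ★ `U(1,1)` files and the `IsChiSection` currency of the ★ DEFS LEAF are equivalent.
[cite: MoeglinWaldspurger1995, I.2.17, II.1.5] -/
theorem isChiSection_of_borelLaw {f : (quasiSplit F E c 2).Adelic → ℂ} {z : ℂ}
    (hf : ∀ (b g : (quasiSplit F E c 2).Adelic) (u : (AdeleRing (𝓞 E) E)ˣ),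
      ((b.1 : GL (Fin 2) (AdeleRing (𝓞 E) E)) : Matrix (Fin 2) (Fin 2) (AdeleRing (𝓞 E) E)) 1 0 = 0 →
      (u : AdeleRing (𝓞 E) E) = ((b.1 : GL (Fin 2) (AdeleRing (𝓞 E) E)) : Matrix (Fin 2) (Fin 2) (AdeleRing (𝓞 E) E)) 0 0 →
        f (b * g) = ((χ u : ℂˣ) : ℂ) * ((ideleNorm u : ℝ) : ℂ) ^ z * f g) :
    IsChiSection χ (fun g => f g * (((borelHeight g : ℝ≥0) : ℝ) : ℂ) ^ (-z)) := fun b hb g => by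
  have hN : (((IdeleClassGroup.ideleNorm E (firstEntryUnit hb) : ℝ≥0) : ℝ) : ℂ) ^ z ≠ 0 := by
    rw [Ne, Complex.cpow_eq_zero_iff, not_and_or]
    exact Or.inl (by exact_mod_cast ideleNorm_ne_zero _)
  simp only []
  rw [borel_mul_of_borelLaw hf hb g, borelHeight_borel_mul_eq_ideleNorm_firstEntryUnit_mul hb g, NNReal.coe_mul, Complex.ofReal_mul,
    Complex.mul_cpow_ofReal_nonneg (NNReal.coe_nonneg _) (NNReal.coe_nonneg _), ← coe_ideleNorm,
    Complex.cpow_neg (((IdeleClassGroup.ideleNorm E (firstEntryUnit hb) : ℝ≥0) : ℝ) : ℂ) z]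
  linear_combination (((χ (firstEntryUnit hb) : ℂˣ) : ℂ) * f g * (((borelHeight g : ℝ≥0) : ℝ) : ℂ) ^ (-z)) * mul_inv_cancel₀ hN

end RankOne

/-! ## §4 Constructors: functions of the last row, products, right translates and right convolutions (any `N`) -/

section Constructors

variable {χ : HeckeCharacter E} {φ ψ : (quasiSplit F E c N).Adelic → ℂ}

/-- The last row scales by the last diagonal entry: `e_N·(b g) = b_{N−1,N−1} · (e_N·g)` (★ `lastRow_borel_mul`, idele packaging). [cite: Garrett2018, §2.2] -/
theorem lastRow_borel_mul_eq_lastEntryUnit_smul {b : (quasiSplit F E c N).Adelic} (hb : b ∈ borelAdelic F E c N) (g : (quasiSplit F E c N).Adelic) :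
    lastRow (b * g) = (lastEntryUnit hb : AdeleRing (𝓞 E) E) • lastRow g :=
  lastRow_borel_mul hb g

/-- For an involution `c`, through the FIRST entry: `e_N·(b g) = ((c ⊗ 1) b₀₀)⁻¹ · (e_N·g)`. [cite: Garrett2018, §2.2] [cite: GelbartRogawski1991, §3.1] -/
theorem lastRow_borel_mul_eq_inv_firstEntryUnit_smul (hc : c * c = 1) {b : (quasiSplit F E c N).Adelic} (hb : b ∈ borelAdelic F E c N) (g : (quasiSplit F E c N).Adelic) :
    lastRow (b * g) = (((Units.map (conjAdele F E c : AdeleRing (𝓞 E) E →+* AdeleRing (𝓞 E) E).toMonoidHom (firstEntryUnit hb))⁻¹ : (AdeleRing (𝓞 E) E)ˣ) : AdeleRing (𝓞 E) E) •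
      lastRow g := by
  rw [lastRow_borel_mul_eq_lastEntryUnit_smul hb g, lastEntryUnit_eq_inv_unitsMap_firstEntryUnit hc hb]

/-- **Dilation laws of functions of the last row pass to `B(𝔸_F)`**: if `ψ(a·(e_N·g)) = ε(a)·ψ(e_N·g)` for all ideles `a`, then `ψ(e_N·(b g)) = ε(b_{N−1,N−1})·ψ(e_N·g)` for
`b ∈ B(𝔸_F)` (`ε : 𝔸_Eˣ → ℂ` arbitrary — e.g. an archimedean angular character, not necessarily automorphic). [cite: Garrett2018, §2.2] [cite: MoeglinWaldspurger1995, I.2.17] -/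
theorem apply_lastRow_borel_mul {ψ : (Fin N → AdeleRing (𝓞 E) E) → ℂ} {ε : (AdeleRing (𝓞 E) E)ˣ → ℂ}
    (hψ : ∀ (a : (AdeleRing (𝓞 E) E)ˣ) (g : (quasiSplit F E c N).Adelic), ψ ((a : AdeleRing (𝓞 E) E) • lastRow g) = ε a * ψ (lastRow g))
    {b : (quasiSplit F E c N).Adelic} (hb : b ∈ borelAdelic F E c N) (g : (quasiSplit F E c N).Adelic) :
    ψ (lastRow (b * g)) = ε (lastEntryUnit hb) * ψ (lastRow g) := by
  rw [lastRow_borel_mul_eq_lastEntryUnit_smul hb g]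
  exact hψ (lastEntryUnit hb) g

/-- **THE CONSTRUCTOR — functions of the last row with dilation law `χʷ` are `χ`-sections**: if `ψ(a·(e_N·g)) = χʷ(a)·ψ(e_N·g)` for all ideles `a` (`χʷ = reflectChar c χ`), then
`φ(g) := ψ(e_N·g)` is a `χ`-section (`χʷ(b_{N−1,N−1}) = χ(b₀₀)`, §1).  This is how `K_∞`-type angular factors and finite-level sections (functions of the last row, ★ (D5-b′)
`K2E1KTypeAngularSectionU2`) are minted. [cite: MoeglinWaldspurger1995, I.2.17] [cite: Garrett2018, §2.2] -/
theorem isChiSection_comp_lastRow {ψ : (Fin N → AdeleRing (𝓞 E) E) → ℂ}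
    (hψ : ∀ (a : (AdeleRing (𝓞 E) E)ˣ) (g : (quasiSplit F E c N).Adelic),
      ψ ((a : AdeleRing (𝓞 E) E) • lastRow g) = ((reflectChar c χ a : ℂˣ) : ℂ) * ψ (lastRow g)) :
    IsChiSection χ (fun g : (quasiSplit F E c N).Adelic => ψ (lastRow g)) := fun b hb g => by
  simp only []
  rw [apply_lastRow_borel_mul hψ hb g, apply_firstEntryUnit_eq_reflectChar_lastEntryUnit χ hb]

/-- The same with the dilation character given: for an involution `c`, if `ψ(a·(e_N·g)) = χ̃(a)·ψ(e_N·g)` then `g ↦ ψ(e_N·g)` is a `χ̃ʷ`-section (`(χ̃ʷ)ʷ = χ̃`, ★ `reflectChar_reflectChar`).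
[cite: MoeglinWaldspurger1995, I.2.17, II.1.7] -/
theorem isChiSection_reflectChar_comp_lastRow (hc : c * c = 1) {χt : HeckeCharacter E} {ψ : (Fin N → AdeleRing (𝓞 E) E) → ℂ}
    (hψ : ∀ (a : (AdeleRing (𝓞 E) E)ˣ) (g : (quasiSplit F E c N).Adelic), ψ ((a : AdeleRing (𝓞 E) E) • lastRow g) = ((χt a : ℂˣ) : ℂ) * ψ (lastRow g)) :
    IsChiSection (reflectChar c χt) (fun g : (quasiSplit F E c N).Adelic => ψ (lastRow g)) :=
  isChiSection_comp_lastRow (χ := reflectChar c χt) (by simpa only [reflectChar_reflectChar hc] using hψ)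

/-- **Products**: a `χ₁`-section times a `χ₂`-section is a `χ₁χ₂`-section. [cite: MoeglinWaldspurger1995, I.2.17] -/
theorem _root_.Summit.HodgeConjecture.HodgeConjecture.Cruxes.H413.K2E1CharacterEisensteinU2Defs.IsChiSection.mul {χ₁ χ₂ : HeckeCharacter E} (hφ : IsChiSection χ₁ φ) (hψ : IsChiSection χ₂ ψ) : IsChiSection (χ₁ * χ₂) (φ * ψ) := fun b hb g => by
  rw [Pi.mul_apply, Pi.mul_apply, hφ b hb g, hψ b hb g, HeckeCharacter.mul_apply, Units.val_mul]
  ring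

/-- **Products of two Borel laws through `b₀₀`**: if `φ(b g) = ε₁(b₀₀)φ(g)` and `ψ(b g) = ε₂(b₀₀)ψ(g)` with ARBITRARY `ε₁, ε₂ : 𝔸_Eˣ → ℂ` (e.g. a finite-level∕`χ_f` datum and an
archimedean angular `K_∞`-type factor — neither automorphic by itself) and `ε₁·ε₂ = χ` pointwise, then `φ·ψ` is a `χ`-section — the honest form of «(D5-b′) angular sections are
`χ_∞`-sections». [cite: MoeglinWaldspurger1995, I.2.17] -/
theorem isChiSection_mul_of_borelLaws {ε₁ ε₂ : (AdeleRing (𝓞 E) E)ˣ → ℂ}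
    (hφ : ∀ (b : (quasiSplit F E c N).Adelic) (hb : b ∈ borelAdelic F E c N) (g : (quasiSplit F E c N).Adelic), φ (b * g) = ε₁ (firstEntryUnit hb) * φ g)
    (hψ : ∀ (b : (quasiSplit F E c N).Adelic) (hb : b ∈ borelAdelic F E c N) (g : (quasiSplit F E c N).Adelic), ψ (b * g) = ε₂ (firstEntryUnit hb) * ψ g)
    (hε : ∀ a : (AdeleRing (𝓞 E) E)ˣ, ε₁ a * ε₂ a = ((χ a : ℂˣ) : ℂ)) :
    IsChiSection χ (φ * ψ) := fun b hb g => by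
  rw [Pi.mul_apply, Pi.mul_apply, hφ b hb g, hψ b hb g, ← hε (firstEntryUnit hb)]
  ring

/-- **Right translates of `χ`-sections are `χ`-sections** (`K`-types, `g ↦ φ(g k)`). [cite: MoeglinWaldspurger1995, I.2.17] -/
theorem _root_.Summit.HodgeConjecture.HodgeConjecture.Cruxes.H413.K2E1CharacterEisensteinU2Defs.IsChiSection.comp_mul_right (hφ : IsChiSection χ φ) (k : (quasiSplit F E c N).Adelic) : IsChiSection χ (fun g => φ (g * k)) := fun b hb g => by
  simp only []
  rw [mul_assoc, hφ.borel_mul hb]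

/-- **Right convolutions preserve `χ`-sections**: `g ↦ ∫ h(x) · φ(g · k(x)) dμ(x)` is a `χ`-section for any measure space `(α, μ)`, weight `h : α → ℂ` and `k : α → G(𝔸)` (the Hecke
operators `R(h)φ(g) = ∫_G h(k) φ(g k) dk` of SHEET row 10; no convergence needed — Bochner junk is `0` on both sides consistently via `integral_const_mul`).
[cite: MoeglinWaldspurger1995, I.2.17, II.1.6] -/
theorem _root_.Summit.HodgeConjecture.HodgeConjecture.Cruxes.H413.K2E1CharacterEisensteinU2Defs.IsChiSection.integral_comp_mul_right (hφ : IsChiSection χ φ) {α : Type*} [MeasurableSpace α] (μ : Measure α) (h : α → ℂ)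
    (k : α → (quasiSplit F E c N).Adelic) : IsChiSection χ (fun g => ∫ x, h x * φ (g * k x) ∂μ) := fun b hb g => by
  simp only []
  rw [← integral_const_mul]
  refine integral_congr_ae (Filter.Eventually.of_forall fun x => ?_)
  dsimp only
  rw [mul_assoc b g (k x), hφ.borel_mul hb]
  ring

/-- Flat sections commute with right translation by height-preserving elements (`H(g k) = H(g)`, e.g. `k ∈ K`, ★ `borelHeight_mul_of_mem_comap_standardMaximalCompactGL`):
`flatSectionU (φ(·k)) z = (flatSectionU φ z)(·k)`. [cite: MoeglinWaldspurger1995, II.1.5] -/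
theorem flatSectionU_comp_mul_right_of_borelHeight {k : (quasiSplit F E c N).Adelic} (hk : ∀ g : (quasiSplit F E c N).Adelic, borelHeight (g * k) = borelHeight g)
    (φ' : (quasiSplit F E c N).Adelic → ℂ) (z : ℂ) :
    flatSectionU (fun g => φ' (g * k)) z = fun g => flatSectionU φ' z (g * k) := by
  funext g
  rw [flatSectionU_apply, flatSectionU_apply, hk g]

end Constructors

end Summit.HodgeConjecture.HodgeConjecture.Cruxes.H413.K2E1ChiSectionBridgeU2

end
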